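import Mathlib

/-!
# A2Galois — a Galois-stable Lagrange interpolation polynomial has coefficients in the base field

Kernel-checked form of the rationality clause of Lemma A4.2.2 of route/T4-A2-p6.md (sub-claim
A2 of route/TIER4.md, cell pub-hodge-repro2; the same argument is Lemma A2.2(ii) of
sub-claim A1 and Step 1 of Prop. A8.1): let `L/F` be a Galois extension of fields, `Λ ⊂ L` a
finite set of "eigenvalues" stable under `Gal(L/F)` and `Λ_W ⊆ Λ` a `Gal(L/F)`-stable subset.
Then the Lagrange polynomial

  `P = ∑_{λ ∈ Λ_W} ∏_{μ ∈ Λ, μ ≠ λ} (X − μ)/(λ − μ)`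

(which takes the value `1` on `Λ_W` and `0` on `Λ ∖ Λ_W`) is fixed by every
`σ ∈ Gal(L/F)` acting on the coefficients, hence has all its coefficients in `F`.

In the section: `L = F₁ = τ₁(F)` (the Galois closure inside `ℂ` of the sextic CM field, which
is Galois over `ℚ`), `F = ℚ`, `Λ` = the eigenvalues `σ(x)σ'(x)` of `ι_i(x)^*` on `H²(A_i, ℂ)`,
`Λ_W = {τ_ν(x)τ̄_ν(x)}`, so that `p₂ = P(ι_i(x)^*)` is a `ℚ`-rational idempotent with image
`D_i`.
-/

namespace Summit.Ventures.HodgeRepro2.A2Galois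

open Polynomial

section RingHom

variable {K : Type*} [Field K] [DecidableEq K]

omit [DecidableEq K] in
/-- A ring endomorphism of the field transports a Lagrange basis divisor to the basis divisor
of the transported points. -/
theorem map_basisDivisor (φ : K →+* K) (x y : K) :
    (Lagrange.basisDivisor x y).map φ = Lagrange.basisDivisor (φ x) (φ y) := by
  simp [Lagrange.basisDivisor, Polynomial.map_mul, Polynomial.map_sub, map_inv₀]

omit [Field K] in
/-- The image of a finite set under an injective self-map which maps the set into itself is
the set itself. -/
theorem image_eq_self_of_mapsTo {φ : K → K} (hφ : Function.Injective φ) (Λ : Finset K)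
    (hΛ : ∀ x ∈ Λ, φ x ∈ Λ) : Λ.image φ = Λ := by
  apply Finset.eq_of_subset_of_card_le
  · intro y hy
    obtain ⟨x, hx, rfl⟩ := Finset.mem_image.mp hy
    exact hΛ x hx
  · rw [Finset.card_image_of_injective _ hφ]

/-- Transport of a Lagrange basis polynomial of a `φ`-stable node set: `φ` permutes the
nodes, and `basis Λ id λ` goes to `basis Λ id (φ λ)`. -/
theorem map_lagrangeBasis (φ : K →+* K) (Λ : Finset K) (hΛ : ∀ x ∈ Λ, φ x ∈ Λ) (l : K) :
    (Lagrange.basis Λ id l).map φ = Lagrange.basis Λ id (φ l) := by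
  have hinj : Function.Injective φ := φ.injective
  unfold Lagrange.basis
  rw [Polynomial.map_prod]
  simp only [map_basisDivisor]
  have himg : (Λ.erase l).image φ = Λ.erase (φ l) := by
    rw [Finset.image_erase hinj, image_eq_self_of_mapsTo hinj Λ hΛ]
  rw [← himg, Finset.prod_image (fun x _ y _ hxy => hinj hxy)]
  rfl

/-- The Lagrange interpolation polynomial of the characteristic function of `Λ_W ⊆ Λ`. -/
noncomputable def lagrangeIndicator (Λ Λ_W : Finset K) : K[X] :=
  ∑ l ∈ Λ_W, Lagrange.basis Λ id l

/-- If `φ` maps `Λ` into itself and `Λ_W` into itself, the indicator polynomial is fixed by `φ`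
acting on the coefficients. -/
theorem map_lagrangeIndicator (φ : K →+* K) (Λ Λ_W : Finset K)
    (hΛ : ∀ x ∈ Λ, φ x ∈ Λ) (hΛW : ∀ x ∈ Λ_W, φ x ∈ Λ_W) :
    (lagrangeIndicator Λ Λ_W).map φ = lagrangeIndicator Λ Λ_W := by
  have hinj : Function.Injective φ := φ.injective
  unfold lagrangeIndicator
  rw [Polynomial.map_sum]
  calc ∑ l ∈ Λ_W, (Lagrange.basis Λ id l).map φ
      = ∑ l ∈ Λ_W, Lagrange.basis Λ id (φ l) := by
        refine Finset.sum_congr rfl (fun l _ => ?_)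
        exact map_lagrangeBasis φ Λ hΛ l
    _ = ∑ l ∈ Λ_W.image φ, Lagrange.basis Λ id l := by
        rw [Finset.sum_image (fun x _ y _ hxy => hinj hxy)]
    _ = ∑ l ∈ Λ_W, Lagrange.basis Λ id l := by
        rw [image_eq_self_of_mapsTo hinj Λ_W hΛW]

/-- Values: the indicator polynomial is `1` on `Λ_W` and `0` on `Λ ∖ Λ_W`
(the interpolation property of the Lagrange basis). -/
theorem lagrangeIndicator_eval (Λ Λ_W : Finset K) (x : K) (hx : x ∈ Λ) :
    (lagrangeIndicator Λ Λ_W).eval x = if x ∈ Λ_W then 1 else 0 := by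
  unfold lagrangeIndicator
  rw [Polynomial.eval_finsetSum]
  have hinj : Function.Injective (id : K → K) := Function.injective_id
  by_cases hxW : x ∈ Λ_W
  · rw [if_pos hxW, Finset.sum_eq_single x]
    · simpa using Lagrange.eval_basis_self (Set.injOn_of_injective hinj) hx
    · intro l hl hlx
      simpa using Lagrange.eval_basis_of_ne (v := (id : K → K)) hlx hx
    · intro h; exact absurd hxW h
  · rw [if_neg hxW]
    refine Finset.sum_eq_zero (fun l hl => ?_)
    have hlx : l ≠ x := fun h => hxW (h ▸ hl)
    simpa using Lagrange.eval_basis_of_ne (v := (id : K → K)) hlx hx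

end RingHom

section Galois

variable {F L : Type*} [Field F] [Field L] [DecidableEq L] [Algebra F L] [IsGalois F L]
  [FiniteDimensional F L]

/-- **Rationality of the Galois-stable Lagrange projector** (Lemma A4.2.2 (ii); Lemma A2.2 (ii)
of sub-claim A1).  If `Λ, Λ_W ⊂ L` are both stable under `Gal(L/F)`, every coefficient of the
indicator polynomial `∑_{λ ∈ Λ_W} ∏_{μ ∈ Λ ∖ {λ}} (X − μ)/(λ − μ)` lies in (the image of) `F`
(the inclusion `Λ_W ⊆ Λ` is needed only for the interpolation values, `lagrangeIndicator_eval`). -/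
theorem coeff_lagrangeIndicator_mem_range (Λ Λ_W : Finset L)
    (hΛ : ∀ (σ : L ≃ₐ[F] L), ∀ x ∈ Λ, σ x ∈ Λ)
    (hΛW : ∀ (σ : L ≃ₐ[F] L), ∀ x ∈ Λ_W, σ x ∈ Λ_W) (n : ℕ) :
    (lagrangeIndicator Λ Λ_W).coeff n ∈ (algebraMap F L).range := by
  -- the coefficient is fixed by every element of the Galois group
  have hfix : ∀ σ : L ≃ₐ[F] L, σ ((lagrangeIndicator Λ Λ_W).coeff n) =
      (lagrangeIndicator Λ Λ_W).coeff n := by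
    intro σ
    have h := map_lagrangeIndicator (σ : L →+* L) Λ Λ_W (hΛ σ) (hΛW σ)
    have := congrArg (fun p : L[X] => p.coeff n) h
    simpa [Polynomial.coeff_map] using this
  -- hence it lies in the fixed field of the whole Galois group, which is `F`
  have hmem : (lagrangeIndicator Λ Λ_W).coeff n ∈
      IntermediateField.fixedField (⊤ : Subgroup (L ≃ₐ[F] L)) := by
    intro σ
    exact hfix σ.1
  rw [IsGalois.fixedField_top] at hmem
  exact IntermediateField.mem_bot.mp hmem

/-- The same, packaged as a polynomial over `F` mapping to the indicator polynomial. -/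
theorem exists_polynomial_map_eq_lagrangeIndicator (Λ Λ_W : Finset L)
    (hΛ : ∀ (σ : L ≃ₐ[F] L), ∀ x ∈ Λ, σ x ∈ Λ)
    (hΛW : ∀ (σ : L ≃ₐ[F] L), ∀ x ∈ Λ_W, σ x ∈ Λ_W) :
    ∃ Q : F[X], Q.map (algebraMap F L) = lagrangeIndicator Λ Λ_W := by
  have hl : lagrangeIndicator Λ Λ_W ∈ Polynomial.lifts (algebraMap F L) := by
    rw [Polynomial.lifts_iff_coeff_lifts]
    intro n
    exact coeff_lagrangeIndicator_mem_range Λ Λ_W hΛ hΛW n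
  exact (Polynomial.mem_lifts _).mp hl

end Galois

end Summit.Ventures.HodgeRepro2.A2Galois
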